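import Summits.QuantumFields.YangMills.Theorems.LuscherReductionTwistedTraceScalingBTRatesAtoms
import HarnessLib

/-!
# (B-T) RATES, part 2: algebraic envelopes of `ε₁`, `ε₂`, `η` and the eventual smallness `ε₁ + ε₂ ≤ 1`
# (lane A of S-BASE, crux `TwistedTraceScaling` stmt-QuantumFields-20203, C4-CORE, the (B-T) pen; design note `pub/ym-fleet/ym-luscher-20007-p1/COARSE-DESIGN.md` §25.9)

Pure real analysis.  §1: for abstract nonnegative reals with `δ ≤ 14p`, `β T² ≤ A ℓ²`, `T ≤ 46 L x ℓ`, `β R² ≤ 1`, `σ ≤ 12 L³ δ²`, `√σ ≤ 4 L² δ²`, `βΓ ≤ N`, `α ≤ x ℓ`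
the three rates of `…BTCorePair` are bounded by explicit `L`-constants times the atoms `p ℓ²` (for `ε₁`) and `W = (p² + x) ℓ⁴` (for `ε₂`, `η`):
`coreEps1_le_atom`, `coreEps2_le_atom`, `coreEta_le_atom`.  §2: along the schedule of `…BTSchedule` (`p = β^{-s}`, `x = β^{-1/2}`, `ℓ = log β`) these hypotheses hold
eventually (`eventually_schedule_facts₂`), whence ★ `eventually_coreEps1_le`, ★ `eventually_coreEps2_le`, ★ `eventually_coreEta_le` (`∃ K, ∀ᶠ β, rate ≤ K · atom`),
`tendsto_btW` (the atom `(β^{-2s} + β^{-1/2}) ℓ⁴ → 0`) and ★★ `eventually_coreEps_sum_le_one` — the conjunct `ε₁ + ε₂ ≤ 1` of the smallness hypothesis of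
`…BTSchedule.recordBT_hT_of_eventually`.
HONEST FRAMING: a stub of a child of the CONDITIONAL reduction route R2b1; C4-CORE OPEN; not infinite volume, not a gap, not Clay.
-/

set_option autoImplicit false

noncomputable section

open MeasureTheory Filter Topology Real Asymptotics
open scoped BigOperators
open Literature.MathematicalPhysics.QuantumFieldTheory
open Literature.MathematicalPhysics.QuantumLattice

namespace Summit.QuantumFields.YangMills.Theorems.FemtoTransferGap.TwoLattice.ConstTube

open Summit.QuantumFields.YangMills.Theorems.FemtoTransferGap
open Summit.QuantumFields.YangMills.Theorems.FemtoTransferGap.TwoLattice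
open Summit.QuantumFields.YangMills.Theorems.FemtoTransferGap.TwoLattice.Cov

variable {L : ℕ} [NeZero L]

/-! ## §1 Algebraic envelopes -/

/-- The atoms dominated by `W = (p² + x) ℓ⁴`: `p²ℓ²`, `xℓ³`, `xℓ⁴`, `xℓ`, `p²`, `x ℓ²`. [folklore] -/
theorem atoms_le_W {p x ℓ : ℝ} (hx0 : 0 ≤ x) (hℓ : 1 ≤ ℓ) :
    p ^ 2 * ℓ ^ 2 ≤ (p ^ 2 + x) * ℓ ^ 4 ∧ x * ℓ ^ 3 ≤ (p ^ 2 + x) * ℓ ^ 4 ∧ x * ℓ ^ 4 ≤ (p ^ 2 + x) * ℓ ^ 4 ∧ x * ℓ ≤ (p ^ 2 + x) * ℓ ^ 4 ∧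
      p ^ 2 ≤ (p ^ 2 + x) * ℓ ^ 4 ∧ x * ℓ ^ 2 ≤ (p ^ 2 + x) * ℓ ^ 4 := by
  have hℓ0 : 0 ≤ ℓ := by linarith
  have h14 : (1 : ℝ) ≤ ℓ ^ 4 := one_le_pow₀ hℓ
  have h24 : ℓ ^ 2 ≤ ℓ ^ 4 := pow_le_pow_right₀ hℓ (by norm_num)
  have h34 : ℓ ^ 3 ≤ ℓ ^ 4 := pow_le_pow_right₀ hℓ (by norm_num)
  have h1l4 : ℓ ≤ ℓ ^ 4 := by have := pow_le_pow_right₀ hℓ (show 1 ≤ 4 by norm_num); rwa [pow_one] at this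
  have hp2 : 0 ≤ p ^ 2 := sq_nonneg p
  have hpx : p ^ 2 ≤ p ^ 2 + x := by linarith
  have hxp : x ≤ p ^ 2 + x := by linarith
  have hs0 : 0 ≤ p ^ 2 + x := by linarith
  refine ⟨mul_le_mul hpx h24 (by positivity) hs0, mul_le_mul hxp h34 (by positivity) hs0, mul_le_mul_of_nonneg_right hxp (by positivity),
    mul_le_mul hxp h1l4 hℓ0 hs0, ?_, mul_le_mul hxp h24 (by positivity) hs0⟩
  calc p ^ 2 = p ^ 2 * 1 := (mul_one _).symm
    _ ≤ (p ^ 2 + x) * ℓ ^ 4 := mul_le_mul hpx h14 zero_le_one hs0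

/-- **Envelope of `ε₁`**: `ε₁ ≤ 14(288|E|A + 160 N_P)·pℓ²`. [folklore] -/
theorem coreEps1_le_atom {β δ T R p ℓ A : ℝ} (hβ : 0 ≤ β) (hδ0 : 0 ≤ δ) (hδ : δ ≤ 14 * p) (hℓ : 1 ≤ ℓ) (hT2 : β * T ^ 2 ≤ A * ℓ ^ 2) (hR2 : β * R ^ 2 ≤ 1) :
    coreEps1 L β δ T R ≤ 14 * (288 * (Fintype.card (Edge 3 L) : ℝ) * A + 160 * (Fintype.card (Plaquette 3 L × Fin 3) : ℝ)) * (p * ℓ ^ 2) := by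
  unfold coreEps1
  set E := (Fintype.card (Edge 3 L) : ℝ)
  set NP := (Fintype.card (Plaquette 3 L × Fin 3) : ℝ)
  have hE : 0 ≤ E := Nat.cast_nonneg _
  have hNP : 0 ≤ NP := Nat.cast_nonneg _
  have hp0 : 0 ≤ p := by linarith
  have hA : 0 ≤ A * ℓ ^ 2 := le_trans (by positivity) hT2
  have hl2 : (1 : ℝ) ≤ ℓ ^ 2 := one_le_pow₀ hℓ
  have k1 : δ * (β * T ^ 2) ≤ 14 * p * (A * ℓ ^ 2) := mul_le_mul hδ hT2 (by positivity) (by positivity)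
  have k2 : δ * (β * R ^ 2) ≤ 14 * p * ℓ ^ 2 :=
    calc δ * (β * R ^ 2) ≤ 14 * p * 1 := mul_le_mul hδ hR2 (by positivity) (by positivity)
      _ ≤ 14 * p * ℓ ^ 2 := mul_le_mul_of_nonneg_left hl2 (by positivity)
  calc β * (12 * (E * (2 * δ * T * (12 * T)))) + β * (40 * (2 * δ) * NP * (R ^ 2 + R ^ 2))
        = 288 * E * (δ * (β * T ^ 2)) + 160 * NP * (δ * (β * R ^ 2)) := by ring
    _ ≤ 288 * E * (14 * p * (A * ℓ ^ 2)) + 160 * NP * (14 * p * ℓ ^ 2) :=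
        add_le_add (mul_le_mul_of_nonneg_left k1 (by positivity)) (mul_le_mul_of_nonneg_left k2 (by positivity))
    _ = 14 * (288 * E * A + 160 * NP) * (p * ℓ ^ 2) := by ring

omit [NeZero L] in
/-- The kinetic-step error terms `1728(βT²)√σ + 29376(βT²)T + 700569(βT²)T²` (with and without the `√σ` term) against `W`. [folklore] -/
theorem stepTerms_le_atom {β δ T σ p x ℓ A : ℝ} (hδ0 : 0 ≤ δ) (hδ : δ ≤ 14 * p) (hℓ : 1 ≤ ℓ) (hx0 : 0 ≤ x) (hx1 : x ≤ 1) (hT0 : 0 ≤ T)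
    (hTx : T ≤ 46 * L * x * ℓ) (hT2 : β * T ^ 2 ≤ A * ℓ ^ 2) (hA : 0 ≤ A) (hsσ : Real.sqrt σ ≤ 4 * (L : ℝ) ^ 2 * δ ^ 2) :
    1728 * (β * T ^ 2 * Real.sqrt σ) + 29376 * (β * T ^ 2 * T) + 700569 * (β * T ^ 2 * T ^ 2) ≤
        (1728 * (4 * 196 * A * (L : ℝ) ^ 2) + 29376 * (46 * A * L) + 700569 * (2116 * A * (L : ℝ) ^ 2)) * ((p ^ 2 + x) * ℓ ^ 4) ∧
      29376 * (β * T ^ 2 * T) + 700569 * (β * T ^ 2 * T ^ 2) ≤ (29376 * (46 * A * L) + 700569 * (2116 * A * (L : ℝ) ^ 2)) * ((p ^ 2 + x) * ℓ ^ 4) := by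
  obtain ⟨hW1, hW2, hW3, -, -, -⟩ := atoms_le_W (p := p) hx0 hℓ
  have hL0 : (0 : ℝ) ≤ L := Nat.cast_nonneg _
  have hp0 : 0 ≤ p := by linarith
  have hδ2 : δ ^ 2 ≤ 196 * p ^ 2 :=
    calc δ ^ 2 ≤ (14 * p) ^ 2 := pow_le_pow_left₀ hδ0 hδ 2
      _ = 196 * p ^ 2 := by ring
  have hx2 : x ^ 2 ≤ x := by nlinarith
  have k1 : β * T ^ 2 * Real.sqrt σ ≤ 4 * 196 * A * (L : ℝ) ^ 2 * ((p ^ 2 + x) * ℓ ^ 4) :=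
    calc β * T ^ 2 * Real.sqrt σ ≤ A * ℓ ^ 2 * (4 * (L : ℝ) ^ 2 * δ ^ 2) := mul_le_mul hT2 hsσ (Real.sqrt_nonneg _) (by positivity)
      _ ≤ A * ℓ ^ 2 * (4 * (L : ℝ) ^ 2 * (196 * p ^ 2)) := by gcongr
      _ = 4 * 196 * A * (L : ℝ) ^ 2 * (p ^ 2 * ℓ ^ 2) := by ring
      _ ≤ 4 * 196 * A * (L : ℝ) ^ 2 * ((p ^ 2 + x) * ℓ ^ 4) := mul_le_mul_of_nonneg_left hW1 (by positivity)
  have k2 : β * T ^ 2 * T ≤ 46 * A * L * ((p ^ 2 + x) * ℓ ^ 4) :=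
    calc β * T ^ 2 * T ≤ A * ℓ ^ 2 * (46 * L * x * ℓ) := mul_le_mul hT2 hTx hT0 (by positivity)
      _ = 46 * A * L * (x * ℓ ^ 3) := by ring
      _ ≤ 46 * A * L * ((p ^ 2 + x) * ℓ ^ 4) := mul_le_mul_of_nonneg_left hW2 (by positivity)
  have hT2x : T ^ 2 ≤ 2116 * (L : ℝ) ^ 2 * x * ℓ ^ 2 :=
    calc T ^ 2 ≤ (46 * L * x * ℓ) ^ 2 := pow_le_pow_left₀ hT0 hTx 2
      _ = 2116 * (L : ℝ) ^ 2 * x ^ 2 * ℓ ^ 2 := by ring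
      _ ≤ 2116 * (L : ℝ) ^ 2 * x * ℓ ^ 2 := by gcongr
  have k3 : β * T ^ 2 * T ^ 2 ≤ 2116 * A * (L : ℝ) ^ 2 * ((p ^ 2 + x) * ℓ ^ 4) :=
    calc β * T ^ 2 * T ^ 2 ≤ A * ℓ ^ 2 * (2116 * (L : ℝ) ^ 2 * x * ℓ ^ 2) := mul_le_mul hT2 hT2x (by positivity) (by positivity)
      _ = 2116 * A * (L : ℝ) ^ 2 * (x * ℓ ^ 4) := by ring
      _ ≤ 2116 * A * (L : ℝ) ^ 2 * ((p ^ 2 + x) * ℓ ^ 4) := mul_le_mul_of_nonneg_left hW3 (by positivity)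
  have i1 := mul_le_mul_of_nonneg_left k1 (show (0 : ℝ) ≤ 1728 by norm_num)
  have i2 := mul_le_mul_of_nonneg_left k2 (show (0 : ℝ) ≤ 29376 by norm_num)
  have i3 := mul_le_mul_of_nonneg_left k3 (show (0 : ℝ) ≤ 700569 by norm_num)
  constructor
  · refine (add_le_add (add_le_add i1 i2) i3).trans (le_of_eq ?_); ring
  · refine (add_le_add i2 i3).trans (le_of_eq ?_); ring

/-- **Envelope of `ε₂`**: `ε₂ ≤ K₂(L, A)·(p² + x)ℓ⁴`. [folklore] -/
theorem coreEps2_le_atom {β δ T R σ p x ℓ A : ℝ} (hβ : 0 ≤ β) (hδ0 : 0 ≤ δ) (hδ : δ ≤ 14 * p) (hℓ : 1 ≤ ℓ) (hx0 : 0 ≤ x) (hx1 : x ≤ 1)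
    (hT0 : 0 ≤ T) (hTx : T ≤ 46 * L * x * ℓ) (hT2 : β * T ^ 2 ≤ A * ℓ ^ 2) (hA : 0 ≤ A) (hR2 : β * R ^ 2 ≤ 1)
    (hσδ : σ ≤ 12 * (L : ℝ) ^ 3 * δ ^ 2) (hsσ : Real.sqrt σ ≤ 4 * (L : ℝ) ^ 2 * δ ^ 2) :
    coreEps2 L β δ T R σ ≤
      (576 * 196 * (Fintype.card (Edge 3 L) : ℝ) * A + 50 * (12 * 196 * (L : ℝ) ^ 3) * (Fintype.card (Plaquette 3 L × Fin 3) : ℝ) +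
          (Fintype.card (Plaquette 3 L) : ℝ) * (1728 * (4 * 196 * A * (L : ℝ) ^ 2) + 29376 * (46 * A * L) + 700569 * (2116 * A * (L : ℝ) ^ 2)) +
          (Fintype.card (Plaquette 3 L) : ℝ) * (29376 * (46 * A * L) + 700569 * (2116 * A * (L : ℝ) ^ 2)) +
          145000000 * 196 * (Fintype.card (Plaquette 3 L × Fin 3) : ℝ)) *
        ((p ^ 2 + x) * ℓ ^ 4) := by
  obtain ⟨hW1, -, -, -, hW5, -⟩ := atoms_le_W (p := p) hx0 hℓ
  obtain ⟨kc, kd⟩ := stepTerms_le_atom (β := β) (σ := σ) hδ0 hδ hℓ hx0 hx1 hT0 hTx hT2 hA hsσ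
  set W := (p ^ 2 + x) * ℓ ^ 4 with hWdef
  set E := (Fintype.card (Edge 3 L) : ℝ)
  set NP := (Fintype.card (Plaquette 3 L × Fin 3) : ℝ)
  set Npl := (Fintype.card (Plaquette 3 L) : ℝ)
  have hE : 0 ≤ E := Nat.cast_nonneg _
  have hNP : 0 ≤ NP := Nat.cast_nonneg _
  have hNpl : 0 ≤ Npl := Nat.cast_nonneg _
  have hL0 : (0 : ℝ) ≤ L := Nat.cast_nonneg _
  have hp0 : 0 ≤ p := by linarith
  have hW0 : 0 ≤ W := by positivity
  have hδ2 : δ ^ 2 ≤ 196 * p ^ 2 :=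
    calc δ ^ 2 ≤ (14 * p) ^ 2 := pow_le_pow_left₀ hδ0 hδ 2
      _ = 196 * p ^ 2 := by ring
  have hβT : 0 ≤ β * T ^ 2 := by positivity
  have hβR : 0 ≤ β * R ^ 2 := by positivity
  have hsq : Real.sqrt NP ^ 2 = NP := Real.sq_sqrt hNP
  -- the exact decomposition
  have hdec : coreEps2 L β δ T R σ = 576 * E * (δ ^ 2 * (β * T ^ 2)) + 50 * NP * (σ * (β * R ^ 2)) +
      Npl * (1728 * (β * T ^ 2 * Real.sqrt σ) + 29376 * (β * T ^ 2 * T) + 700569 * (β * T ^ 2 * T ^ 2)) +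
      Npl * (29376 * (β * T ^ 2 * T) + 700569 * (β * T ^ 2 * T ^ 2)) + 145000000 * NP * (δ ^ 2 * (β * R ^ 2)) := by
    unfold coreEps2 stepActionErr
    rw [Real.sqrt_zero]
    linear_combination (50 * β * σ * R ^ 2) * hsq
  have ka : δ ^ 2 * (β * T ^ 2) ≤ 196 * A * W :=
    calc δ ^ 2 * (β * T ^ 2) ≤ 196 * p ^ 2 * (A * ℓ ^ 2) := mul_le_mul hδ2 hT2 hβT (by positivity)
      _ = 196 * A * (p ^ 2 * ℓ ^ 2) := by ring
      _ ≤ 196 * A * W := mul_le_mul_of_nonneg_left hW1 (by positivity)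
  have kb : σ * (β * R ^ 2) ≤ 12 * 196 * (L : ℝ) ^ 3 * W :=
    calc σ * (β * R ^ 2) ≤ 12 * (L : ℝ) ^ 3 * δ ^ 2 * 1 := mul_le_mul hσδ hR2 hβR (by positivity)
      _ ≤ 12 * (L : ℝ) ^ 3 * (196 * p ^ 2) * 1 := by gcongr
      _ = 12 * 196 * (L : ℝ) ^ 3 * p ^ 2 := by ring
      _ ≤ 12 * 196 * (L : ℝ) ^ 3 * W := mul_le_mul_of_nonneg_left hW5 (by positivity)
  have ke : δ ^ 2 * (β * R ^ 2) ≤ 196 * W :=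
    calc δ ^ 2 * (β * R ^ 2) ≤ 196 * p ^ 2 * 1 := mul_le_mul hδ2 hR2 hβR (by positivity)
      _ ≤ 196 * W := by rw [mul_one]; exact mul_le_mul_of_nonneg_left hW5 (by norm_num)
  rw [hdec]
  have hsum := add_le_add (add_le_add (add_le_add (add_le_add (mul_le_mul_of_nonneg_left ka (show 0 ≤ 576 * E by positivity))
    (mul_le_mul_of_nonneg_left kb (show 0 ≤ 50 * NP by positivity))) (mul_le_mul_of_nonneg_left kc hNpl))
    (mul_le_mul_of_nonneg_left kd hNpl)) (mul_le_mul_of_nonneg_left ke (show 0 ≤ 145000000 * NP by positivity))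
  refine hsum.trans (le_of_eq ?_)
  ring

/-- **Envelope of `η`**: `η ≤ K₃(L, A, N)·(p² + x)ℓ⁴`. [folklore] -/
theorem coreEta_le_atom {β δ α T R Γ σ p x ℓ A N : ℝ} (hβ : 0 ≤ β) (hδ0 : 0 ≤ δ) (hδ : δ ≤ 14 * p) (hδ1 : δ ≤ 1) (hℓ : 1 ≤ ℓ) (hx0 : 0 ≤ x)
    (hx1 : x ≤ 1) (hT0 : 0 ≤ T) (hTx : T ≤ 46 * L * x * ℓ) (hT2 : β * T ^ 2 ≤ A * ℓ ^ 2) (hA : 0 ≤ A)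
    (hR2 : β * R ^ 2 ≤ 1) (hσδ : σ ≤ 12 * (L : ℝ) ^ 3 * δ ^ 2) (hsσ : Real.sqrt σ ≤ 4 * (L : ℝ) ^ 2 * δ ^ 2) (hα0 : 0 ≤ α) (hα : α ≤ x * ℓ)
    (hΓ0 : 0 ≤ Γ) (hΓ : β * Γ ≤ N) (hN : 0 ≤ N) :
    coreEta L β δ α T R Γ σ ≤
      ((Fintype.card (Edge 3 L) : ℝ) * (558 * A + 192 * A) + 216 * N + 50 * (Fintype.card (Plaquette 3 L × Fin 3) : ℝ) * (12 * 196 * (L : ℝ) ^ 3) +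
          (Fintype.card (Plaquette 3 L) : ℝ) * (1728 * (4 * 196 * A * (L : ℝ) ^ 2) + 29376 * (46 * A * L) + 700569 * (2116 * A * (L : ℝ) ^ 2)) +
          5040 * (Fintype.card (Plaquette 3 L × Fin 3) : ℝ)) * ((p ^ 2 + x) * ℓ ^ 4) := by
  obtain ⟨-, hW2, hW3, hW4, hW5, -⟩ := atoms_le_W (p := p) hx0 hℓ
  set W := (p ^ 2 + x) * ℓ ^ 4 with hWdef
  set E := (Fintype.card (Edge 3 L) : ℝ)
  set NP := (Fintype.card (Plaquette 3 L × Fin 3) : ℝ)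
  set Npl := (Fintype.card (Plaquette 3 L) : ℝ)
  have hE : 0 ≤ E := Nat.cast_nonneg _
  have hNP : 0 ≤ NP := Nat.cast_nonneg _
  have hNpl : 0 ≤ Npl := Nat.cast_nonneg _
  have hL0 : (0 : ℝ) ≤ L := Nat.cast_nonneg _
  have hp0 : 0 ≤ p := by linarith
  have hℓ0 : 0 ≤ ℓ := by linarith
  have hW0 : 0 ≤ W := by positivity
  have hδ2 : δ ^ 2 ≤ 196 * p ^ 2 := by nlinarith
  have hxℓ0 : 0 ≤ x * ℓ := by positivity
  have hβT : 0 ≤ β * T ^ 2 := by positivity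
  have hβR : 0 ≤ β * R ^ 2 := by positivity
  have hdec : coreEta L β δ α T R Γ σ = E * (558 * (α ^ 2 * (β * T ^ 2)) + 192 * (α * (β * T ^ 2))) + 216 * (α * δ * (β * Γ)) +
      50 * NP * (σ * (β * R ^ 2)) + Npl * (1728 * (β * T ^ 2 * Real.sqrt σ) + 29376 * (β * T ^ 2 * T) + 700569 * (β * T ^ 2 * T ^ 2)) +
      5040 * NP * (α * (β * R ^ 2)) := by
    unfold coreEta stepActionErr; ring
  have k1 : α ^ 2 * (β * T ^ 2) ≤ A * W := by
    have hα2 : α ^ 2 ≤ x * ℓ ^ 2 := by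
      calc α ^ 2 ≤ (x * ℓ) ^ 2 := pow_le_pow_left₀ hα0 hα 2
        _ = x * x * ℓ ^ 2 := by ring
        _ ≤ 1 * x * ℓ ^ 2 := by gcongr
        _ = x * ℓ ^ 2 := by ring
    calc α ^ 2 * (β * T ^ 2) ≤ x * ℓ ^ 2 * (A * ℓ ^ 2) := mul_le_mul hα2 hT2 hβT (by positivity)
      _ = A * (x * ℓ ^ 4) := by ring
      _ ≤ A * W := mul_le_mul_of_nonneg_left hW3 hA
  have k2 : α * (β * T ^ 2) ≤ A * W :=
    calc α * (β * T ^ 2) ≤ x * ℓ * (A * ℓ ^ 2) := mul_le_mul hα hT2 hβT hxℓ0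
      _ = A * (x * ℓ ^ 3) := by ring
      _ ≤ A * W := mul_le_mul_of_nonneg_left hW2 hA
  have k3 : α * δ * (β * Γ) ≤ N * W := by
    have h1 : α * δ ≤ x * ℓ * 1 := mul_le_mul hα hδ1 hδ0 hxℓ0
    calc α * δ * (β * Γ) ≤ x * ℓ * 1 * N := mul_le_mul h1 hΓ (by positivity) (by positivity)
      _ = N * (x * ℓ) := by ring
      _ ≤ N * W := mul_le_mul_of_nonneg_left hW4 hN
  have k4 : σ * (β * R ^ 2) ≤ 12 * 196 * (L : ℝ) ^ 3 * W :=
    calc σ * (β * R ^ 2) ≤ 12 * (L : ℝ) ^ 3 * δ ^ 2 * 1 := mul_le_mul hσδ hR2 hβR (by positivity)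
      _ ≤ 12 * (L : ℝ) ^ 3 * (196 * p ^ 2) * 1 := by gcongr
      _ = 12 * 196 * (L : ℝ) ^ 3 * p ^ 2 := by ring
      _ ≤ 12 * 196 * (L : ℝ) ^ 3 * W := mul_le_mul_of_nonneg_left hW5 (by positivity)
  obtain ⟨k5, -⟩ := stepTerms_le_atom (β := β) (σ := σ) hδ0 hδ hℓ hx0 hx1 hT0 hTx hT2 hA hsσ
  rw [← hWdef] at k5
  have k6 : α * (β * R ^ 2) ≤ W :=
    calc α * (β * R ^ 2) ≤ x * ℓ * 1 := mul_le_mul hα hR2 hβR hxℓ0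
      _ ≤ W := by rw [mul_one]; exact hW4
  rw [hdec]
  have hsum := add_le_add (add_le_add (add_le_add (add_le_add
    (mul_le_mul_of_nonneg_left (add_le_add (mul_le_mul_of_nonneg_left k1 (show (0 : ℝ) ≤ 558 by norm_num))
      (mul_le_mul_of_nonneg_left k2 (show (0 : ℝ) ≤ 192 by norm_num))) hE)
    (mul_le_mul_of_nonneg_left k3 (show (0 : ℝ) ≤ 216 by norm_num)))
    (mul_le_mul_of_nonneg_left k4 (show 0 ≤ 50 * NP by positivity))) (mul_le_mul_of_nonneg_left k5 hNpl))
    (mul_le_mul_of_nonneg_left k6 (show 0 ≤ 5040 * NP by positivity))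
  refine hsum.trans (le_of_eq ?_)
  ring

/-! ## §2 The schedule satisfies the hypotheses of §1, eventually -/

/-- Eventually along the schedule (`δ = δ₁`, `T = 9L·R₁ + ε`, `R = r`, `x = β^{-1/2}`, `p = β^{-s}`, `ℓ = log β`, `σ = 12L³δ⁴`, `Γ = ε|Site|`, `α = xℓ`):
all the elementary hypotheses of the envelopes of §1. [folklore] -/
theorem eventually_schedule_facts₂ {s : ℝ} (hs : 0 < s) (hs2 : s < 1 / 2) :
    ∀ᶠ β : ℝ in atTop, 1 ≤ β ∧ btLog β = Real.log β ∧ 1 ≤ btLog β ∧ btRad β = powScale (1 / 2) β ∧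
      0 ≤ recordDelta1 L s β ∧ recordDelta1 L s β ≤ 14 * powScale s β ∧ recordDelta1 L s β ≤ 1 ∧
      0 ≤ powScale (1 / 2) β ∧ powScale (1 / 2) β ≤ 1 ∧ powScale s β ^ 2 = powScale (2 * s) β ∧
      0 ≤ 9 * L * btR1 β + btEps β ∧ 9 * L * btR1 β + btEps β ≤ 1 ∧ 9 * L * btR1 β + btEps β ≤ 46 * L * powScale (1 / 2) β * btLog β ∧
      β * (9 * L * btR1 β + btEps β) ^ 2 ≤ 2116 * (L : ℝ) ^ 2 * btLog β ^ 2 ∧ β * btRad β ^ 2 = 1 ∧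
      0 ≤ (L : ℝ) ^ 3 * (12 * recordDelta1 L s β ^ 4) ∧ (L : ℝ) ^ 3 * (12 * recordDelta1 L s β ^ 4) ≤ 2 ∧
      (L : ℝ) ^ 3 * (12 * recordDelta1 L s β ^ 4) ≤ 12 * (L : ℝ) ^ 3 * recordDelta1 L s β ^ 2 ∧
      Real.sqrt ((L : ℝ) ^ 3 * (12 * recordDelta1 L s β ^ 4)) ≤ 4 * (L : ℝ) ^ 2 * recordDelta1 L s β ^ 2 ∧
      β * (btEps β * Fintype.card (Site 3 L)) = (Fintype.card (Site 3 L) : ℝ) ∧ btAlpha β = powScale (1 / 2) β * btLog β ∧ btAlpha β ≤ 1 := by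
  have hL1 : (1 : ℝ) ≤ L := by exact_mod_cast NeZero.one_le
  have hL0 : (0 : ℝ) < L := by linarith
  have hN1 : (1 : ℝ) ≤ Fintype.card (Site 3 L) := by exact_mod_cast Fintype.card_pos
  have hN : (0 : ℝ) < Fintype.card (Site 3 L) := by linarith
  filter_upwards [eventually_schedule_facts (L := L) hs hs2, eventually_small_elementary (L := L) hs hs2] with β hf hel
  obtain ⟨hβ1, hℓeq, hℓ6, hreq, hεx, -, -, -, hδs, -, hδhalf⟩ := hf
  obtain ⟨-, -, hα1, -, hT30, hσ2, -⟩ := hel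
  set x := powScale (1 / 2) β with hxdef
  set δ := recordDelta1 L s β with hδdef
  set ℓ := btLog β with hℓdef
  have hx0 : 0 < x := powScale_pos _ _
  have hx1 : x ≤ 1 := powScale_le_one (by norm_num) β
  have hℓ1 : 1 ≤ ℓ := one_le_btLog β
  have hp0 : 0 < powScale s β := powScale_pos _ _
  have hδ0 : 0 ≤ δ := by rw [hδdef]; unfold recordDelta1; positivity
  have hδp : δ ≤ 14 * powScale s β := by
    rw [hδdef]; unfold recordDelta1; rw [div_le_iff₀ hN]; nlinarith
  have hδ1 : δ ≤ 1 := by linarith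
  have hε0 : 0 < btEps β := powScale_pos _ _
  have hp2 : powScale s β ^ 2 = powScale (2 * s) β := by
    have hβ0 : 0 ≤ β := by linarith
    rw [powScale_eq hβ1, powScale_eq hβ1, ← Real.rpow_mul_natCast hβ0]; congr 1; push_cast; ring
  have hR₁eq : btR1 β = 5 * x * ℓ := rfl
  have hT0 : 0 ≤ 9 * L * btR1 β + btEps β := by rw [hR₁eq]; positivity
  have hTx : 9 * L * btR1 β + btEps β ≤ 46 * L * x * ℓ := by
    rw [hR₁eq]
    have h1 : btEps β ≤ x * ℓ := hεx.trans (le_mul_of_one_le_right hx0.le hℓ1)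
    have h2 : x * ℓ ≤ L * (x * ℓ) := le_mul_of_one_le_left (by positivity) hL1
    nlinarith
  have hβx : β * x ^ 2 = 1 := mul_powScale_half_sq hβ1
  have hT2 : β * (9 * L * btR1 β + btEps β) ^ 2 ≤ 2116 * (L : ℝ) ^ 2 * ℓ ^ 2 := by
    have h := pow_le_pow_left₀ hT0 hTx 2
    calc β * (9 * L * btR1 β + btEps β) ^ 2 ≤ β * (46 * L * x * ℓ) ^ 2 := mul_le_mul_of_nonneg_left h (by linarith)
      _ = 2116 * (L : ℝ) ^ 2 * ℓ ^ 2 * (β * x ^ 2) := by ring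
      _ = 2116 * (L : ℝ) ^ 2 * ℓ ^ 2 := by rw [hβx, mul_one]
  have hβR : β * btRad β ^ 2 = 1 := by rw [hreq]; exact hβx
  have hσ0 : 0 ≤ (L : ℝ) ^ 3 * (12 * δ ^ 4) := by positivity
  have hσδ : (L : ℝ) ^ 3 * (12 * δ ^ 4) ≤ 12 * (L : ℝ) ^ 3 * δ ^ 2 := by
    have h4 : δ ^ 4 ≤ δ ^ 2 := pow_le_pow_of_le_one hδ0 hδ1 (show 2 ≤ 4 by norm_num)
    calc (L : ℝ) ^ 3 * (12 * δ ^ 4) = 12 * (L : ℝ) ^ 3 * δ ^ 4 := by ring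
      _ ≤ 12 * (L : ℝ) ^ 3 * δ ^ 2 := by gcongr
  have hsσ : Real.sqrt ((L : ℝ) ^ 3 * (12 * δ ^ 4)) ≤ 4 * (L : ℝ) ^ 2 * δ ^ 2 := by
    rw [Real.sqrt_le_left (by positivity)]
    have hL34 : (L : ℝ) ^ 3 ≤ (L : ℝ) ^ 4 := pow_le_pow_right₀ hL1 (by norm_num)
    have hδ4 : 0 ≤ δ ^ 4 := by positivity
    calc (L : ℝ) ^ 3 * (12 * δ ^ 4) ≤ (L : ℝ) ^ 4 * (16 * δ ^ 4) := mul_le_mul hL34 (by nlinarith) (by positivity) (by positivity)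
      _ = (4 * (L : ℝ) ^ 2 * δ ^ 2) ^ 2 := by ring
  have hΓ : β * (btEps β * Fintype.card (Site 3 L)) = (Fintype.card (Site 3 L) : ℝ) := by
    rw [← mul_assoc, show btEps β = powScale 1 β from rfl, mul_powScale_one hβ1, one_mul]
  have hαeq : btAlpha β = x * ℓ := rfl
  exact ⟨hβ1, hℓeq, hℓ1, hreq, hδ0, hδp, hδ1, hx0.le, hx1, hp2, hT0, by linarith, hTx, hT2, hβR, hσ0, hσ2.le, hσδ, hsσ, hΓ, hαeq, hα1⟩

/-! ## §3 ★ The rates along the schedule -/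

/-- ★ `ε₁ ≤ K·β^{-s}ℓ²` eventually. [folklore] -/
theorem eventually_coreEps1_le {s : ℝ} (hs : 0 < s) (hs2 : s < 1 / 2) :
    ∃ K : ℝ, 0 ≤ K ∧ ∀ᶠ β : ℝ in atTop,
      coreEps1 L β (recordDelta1 L s β) (9 * L * btR1 β + btEps β) (btRad β) ≤ K * (powScale s β * btLog β ^ 2) := by
  refine ⟨14 * (288 * (Fintype.card (Edge 3 L) : ℝ) * (2116 * (L : ℝ) ^ 2) + 160 * (Fintype.card (Plaquette 3 L × Fin 3) : ℝ)), by positivity, ?_⟩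
  filter_upwards [eventually_schedule_facts₂ (L := L) hs hs2] with β h
  obtain ⟨hβ1, -, hℓ1, -, hδ0, hδp, -, -, -, -, -, -, -, hT2, hβR, -⟩ := h
  exact coreEps1_le_atom (by linarith) hδ0 hδp hℓ1 hT2 hβR.le

/-- ★ `ε₂ ≤ K·(β^{-2s} + β^{-1/2})ℓ⁴` eventually. [folklore] -/
theorem eventually_coreEps2_le {s : ℝ} (hs : 0 < s) (hs2 : s < 1 / 2) :
    ∃ K : ℝ, 0 ≤ K ∧ ∀ᶠ β : ℝ in atTop,
      coreEps2 L β (recordDelta1 L s β) (9 * L * btR1 β + btEps β) (btRad β) ((L : ℝ) ^ 3 * (12 * recordDelta1 L s β ^ 4)) ≤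
        K * ((powScale (2 * s) β + powScale (1 / 2) β) * btLog β ^ 4) := by
  set A : ℝ := 2116 * (L : ℝ) ^ 2 with hA
  have hA0 : 0 ≤ A := by rw [hA]; positivity
  refine ⟨576 * 196 * (Fintype.card (Edge 3 L) : ℝ) * A + 50 * (12 * 196 * (L : ℝ) ^ 3) * (Fintype.card (Plaquette 3 L × Fin 3) : ℝ) +
      (Fintype.card (Plaquette 3 L) : ℝ) * (1728 * (4 * 196 * A * (L : ℝ) ^ 2) + 29376 * (46 * A * L) + 700569 * (2116 * A * (L : ℝ) ^ 2)) +
      (Fintype.card (Plaquette 3 L) : ℝ) * (29376 * (46 * A * L) + 700569 * (2116 * A * (L : ℝ) ^ 2)) +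
      145000000 * 196 * (Fintype.card (Plaquette 3 L × Fin 3) : ℝ), by positivity, ?_⟩
  filter_upwards [eventually_schedule_facts₂ (L := L) hs hs2] with β h
  obtain ⟨hβ1, -, hℓ1, -, hδ0, hδp, -, hx0, hx1, hp2, hT0, -, hTx, hT2, hβR, -, -, hσδ, hsσ, -⟩ := h
  have h := coreEps2_le_atom (L := L) (by linarith) hδ0 hδp hℓ1 hx0 hx1 hT0 hTx hT2 hA0 hβR.le hσδ hsσ
  rw [hp2] at h
  exact h

/-- ★ `η ≤ K·(β^{-2s} + β^{-1/2})ℓ⁴` eventually. [folklore] -/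
theorem eventually_coreEta_le {s : ℝ} (hs : 0 < s) (hs2 : s < 1 / 2) :
    ∃ K : ℝ, 0 ≤ K ∧ ∀ᶠ β : ℝ in atTop,
      coreEta L β (recordDelta1 L s β) (btAlpha β) (9 * L * btR1 β + btEps β) (btRad β) (btEps β * Fintype.card (Site 3 L))
          ((L : ℝ) ^ 3 * (12 * recordDelta1 L s β ^ 4)) ≤
        K * ((powScale (2 * s) β + powScale (1 / 2) β) * btLog β ^ 4) := by
  set A : ℝ := 2116 * (L : ℝ) ^ 2 with hA
  have hA0 : 0 ≤ A := by rw [hA]; positivity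
  set N : ℝ := (Fintype.card (Site 3 L) : ℝ) with hNdef
  have hN0 : 0 ≤ N := Nat.cast_nonneg _
  refine ⟨(Fintype.card (Edge 3 L) : ℝ) * (558 * A + 192 * A) + 216 * N + 50 * (Fintype.card (Plaquette 3 L × Fin 3) : ℝ) * (12 * 196 * (L : ℝ) ^ 3) +
      (Fintype.card (Plaquette 3 L) : ℝ) * (1728 * (4 * 196 * A * (L : ℝ) ^ 2) + 29376 * (46 * A * L) + 700569 * (2116 * A * (L : ℝ) ^ 2)) +
      5040 * (Fintype.card (Plaquette 3 L × Fin 3) : ℝ), by positivity, ?_⟩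
  filter_upwards [eventually_schedule_facts₂ (L := L) hs hs2] with β h
  obtain ⟨hβ1, -, hℓ1, -, hδ0, hδp, hδ1, hx0, hx1, hp2, hT0, -, hTx, hT2, hβR, -, -, hσδ, hsσ, hΓ, hαeq, -⟩ := h
  have hβ0 : 0 ≤ β := by linarith
  have h := coreEta_le_atom (L := L) (N := N) hβ0 hδ0 hδp hδ1 hℓ1 hx0 hx1 hT0 hTx hT2 hA0 hβR.le hσδ hsσ (btAlpha_nonneg β) hαeq.le
    (mul_nonneg (btEps_pos_le β).1.le (Nat.cast_nonneg _)) hΓ.le hN0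
  rw [hp2] at h
  exact h

/-- The atom `(β^{-2s} + β^{-1/2})ℓ⁴ → 0`. [folklore] -/
theorem tendsto_btW {s : ℝ} (hs : 0 < s) : Tendsto (fun β : ℝ => (powScale (2 * s) β + powScale (1 / 2) β) * btLog β ^ 4) atTop (𝓝 0) := by
  have h := (tendsto_powScale_mul_btLog_pow (show (0 : ℝ) < 2 * s by linarith) 4).add (tendsto_powScale_mul_btLog_pow (show (0 : ℝ) < 1 / 2 by norm_num) 4)
  rw [add_zero] at h
  exact h.congr' (Eventually.of_forall fun β => by ring)

/-- ★★ **The conjunct `ε₁ + ε₂ ≤ 1` of the smallness hypothesis of `recordBT_hT_of_eventually`**, eventually. [folklore] -/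
theorem eventually_coreEps_sum_le_one {s : ℝ} (hs : 0 < s) (hs2 : s < 1 / 2) :
    ∀ᶠ β : ℝ in atTop,
      coreEps1 L β (recordDelta1 L s β) (9 * L * btR1 β + btEps β) (btRad β) +
          coreEps2 L β (recordDelta1 L s β) (9 * L * btR1 β + btEps β) (btRad β) ((L : ℝ) ^ 3 * (12 * recordDelta1 L s β ^ 4)) ≤ 1 := by
  obtain ⟨K₁, hK₁, h₁⟩ := eventually_coreEps1_le (L := L) hs hs2
  obtain ⟨K₂, hK₂, h₂⟩ := eventually_coreEps2_le (L := L) hs hs2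
  have t₁ := (tendsto_powScale_mul_btLog_pow hs 2).const_mul K₁
  have t₂ := (tendsto_btW hs).const_mul K₂
  rw [mul_zero] at t₁ t₂
  filter_upwards [h₁, h₂, t₁.eventually (eventually_le_nhds (show (0 : ℝ) < 1 / 2 by norm_num)),
    t₂.eventually (eventually_le_nhds (show (0 : ℝ) < 1 / 2 by norm_num))] with β e₁ e₂ s₁ s₂
  linarith

end Summit.QuantumFields.YangMills.Theorems.FemtoTransferGap.TwoLattice.ConstTube

end
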